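/-
Copyright (c) 2026. All rights reserved.
Released under Apache 2.0 license as described in the file LICENSE.
-/
import Literature.Probability.FitznerVanDerHofstad2017.NobleBoundsNDispatchStarU
import Literature.Probability.FitznerVanDerHofstad2017.NobleBoundsNLowStar
import Literature.Probability.FitznerVanDerHofstad2017.NobleBoundsNMidF1
import HarnessLib

/-!
# Fitzner–van der Hofstad (2017), §6.1 (6.4) / §5.1 (5.4), "Elements of the bounds": the `pkg` DISPATCH at the junctions over a CLOSED level (lower `★`) and at `★★` junctions

[FvdH17] = R. Fitzner, R. van der Hofstad, *Mean-field behavior for nearest-neighbor percolation in `d > 10`*,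
arXiv:1506.07977v2 (EJP 22 (2017), paper 43).  Page numbers refer to the arXiv version.

Companion of `NobleBoundsNDispatchReg` (regular class pairs) and `NobleBoundsNDispatchStarU` (upper `★`).  At a
junction `k ≤ M` whose LOWER level `k` is closed (`a_k = ★`, kind `closed`, (4.58)/(4.62), p. 41) the piece is
pinned at level `k` (`w_k = z_k`, (4.64), p. 42 — `JFacts.pin_closedL`), level `k` carries no exit line, and the
column of the extended pointwise family is the PINNED SECTION of ROW `a = 2` of the first term of (5.4),
`𝟙{z_k = w_k} · B_pt^{κ,2,a′}(u_k,w_k,t_k,z_k,w_{k+1},u_{k+1})` (`NobleBoundsNAssemblyStar.secEopt`, §5.1 "Elements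
of the bounds", p. 49); if ALSO the upper level is closed (`★★`) it is `𝟙{w_{k+1} = u_k} 𝟙{z_k = w_k}
B_pt^{κ,2,0}(u_k,w_k,t_k,z_k,u_{k+1},u_{k+1})` (`secEocpt`).  Level `0` is never closed
(`jointWitN … = {ω | s 0 = false ∧ …}`), so a FIRST junction over a closed level carries the empty piece.
This file

* §A: records the vacuity of a closed FIRST level (`nonempty_jPkg_of_closed_zero`: `a_0 = ★` ⇒ every junction
  package, for any target — `side_of_mem_jointWitN`), and the two vacuities of a `★★` junction off its closed
  sections (`nonempty_jPkg_starStar_of_ne`);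
* §B: defines the lower-`★` TARGET FAMILIES `tgtStarL L κ a′ u w t z w′ u′ v := 𝟙{z = w} · tgtReg L κ 2 a′ … v`
  and `tgtStarLU L κ u w t z w′ u′ v := 𝟙{z = w} · tgtStarU L κ 2 … v` (`★★`), with the `hT` bounds
  `Σ_v tgtStarL ≤ 𝟙{z = w} B'_pt^{κ,2,a′}` (`sum_tgtStarL_le`, the column `secEopt`) and
  `Σ_v tgtStarLU ≤ 𝟙{w′ = u} 𝟙{z = w} B'_pt^{κ,2,0}(…,u′,u′)` (`sum_tgtStarLU_le`, the column `secEocpt`);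
* §C: dispatches the `pkg` hypothesis of `NobleBoundsNGrouped.prod_bondJ_mul_piPerc_jwCover_le_chain_of_packages`
  at a MIDDLE junction over a closed level with a regular upper class `a′` (`nonempty_jPkg_mid_starL`): off the
  pinned section the piece is empty (`JFacts.pin_closedL`); the `F‴` rows (`σ = false`) go to the landed cells
  `NobleBoundsNLowStar.nonempty_jPkg_lowStar_zeroExit` (`a′ = 0`) / `…_lowStar_open` (`a′ ≠ 0` off the corner
  `w_{k+1} ≠ t_k`); the vacuous `F′/F″` sub-rows go to the landed kit (`nonempty_jPkg_of_sharp`,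
  `…_of_innerClass_zero_ne / _ne_zero_eq`, `…_of_midE_t_eq_z_ne`).  The cells NOT yet in the tree enter as
  HYPOTHESES with this theorem's own target (named slots, as in `NobleBoundsNDispatchReg`): `hR'` = the corner
  `w_{k+1} = t_k` of the `F‴` rows with `a′ ≠ 0` (DIVERGENCE D77-R′ over `★`), `hF1` = the `F′` row on the pin
  `t_k = u_{k+1}` at inner class `0` over `★`, `hE` = the `F″` rows `a′ = 2` off the pin over `★`.  The `★★`
  packages on the closed sections await the `★★` cells and are not dispatched here.

Conventions: `d`-generic; nothing is cited as a fact; additive (no existing declaration is changed).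
-/

noncomputable section

open scoped ENNReal

namespace Literature.Probability.FitznerVanDerHofstad2017

open Literature.Barriers.CriticalPhenomena Literature.Probability.Percolation
open Literature.Probability.LatticeModels Literature.Combinatorics.SimpleGraph _root_.SimpleGraph
open _root_.MeasureTheory
open Literature.Probability.FitznerVanDerHofstad2017.NobleBlocks
open Literature.Probability.FitznerVanDerHofstad2017.NobleBlocks.LenIdx

variable {d : ℕ}

/-! ### A. Vacuities: a closed first level; a `★★` junction off its closed sections -/

section Vacuous

variable (p : unitInterval) (M : ℕ) (x : Site d) (b : Fin (M + 2) → Site d × Site d) (w t z : Fin (M + 2) → Site d)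
  (a : Fin (M + 2) → Fin 3 ⊕ Unit) (c : Fin 3 ⊕ Unit) (τ : Fin (M + 1) → Bool × Fin 3)

/-- **Level `0` is never closed**: if `a_0 = ★` the variant piece is empty (the joint event records `s 0 = false`,
(4.57): level `0` has no adjoined vertex to pin at), so every junction carries a package for every target.
[cite: FitznerVanDerHofstad2017, (4.57)–(4.58), (4.62) (arXiv:1506.07977v2 p. 41)] -/
theorem nonempty_jPkg_of_closed_zero {u₀ : Unit} (ha : a 0 = Sum.inr u₀) (k : Fin (M + 2)) (tgt : ℝ≥0∞) :
    Nonempty (JPkg p (jctx M x b w t z a τ k) (JFacts M x b w t z a c τ) tgt) :=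
  ⟨JPkg.vacuous p _ _ (fun _ _ hF => by
    have h0 := (side_of_mem_jointWitN hF.mem.2.2.1).1
    simp [clsS, ha] at h0) tgt⟩

/-- **A `★★` junction off the pinned section `z_k = w_k`** carries the empty piece.
[cite: FitznerVanDerHofstad2017, (4.62), (4.64) (arXiv:1506.07977v2 pp. 41–42)] -/
theorem nonempty_jPkg_of_closedL_of_ne (i i₀ : Fin (M + 1)) (hk : i₀.succ = i.castSucc) {u₀ : Unit}
    (ha : a i.castSucc = Sum.inr u₀) (hzw : z i.castSucc ≠ w i.castSucc) (tgt : ℝ≥0∞) :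
    Nonempty (JPkg p (jctx M x b w t z a τ i.castSucc) (JFacts M x b w t z a c τ) tgt) :=
  ⟨JPkg.vacuous p _ _ (fun _ _ hF => hzw (hF.pin_closedL i i₀ hk ha).2.symm) tgt⟩

/-- **A junction below a closed level off the closed section `w_{k+1} = u_k`** carries the empty piece.
[cite: FitznerVanDerHofstad2017, (4.62), (4.64) (arXiv:1506.07977v2 pp. 41–42)] -/
theorem nonempty_jPkg_of_closedU_of_ne (i : Fin (M + 1)) {u₁ : Unit} (ha' : a i.succ = Sum.inr u₁)
    (hw : w i.succ ≠ (b i.castSucc).1) (tgt : ℝ≥0∞) :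
    Nonempty (JPkg p (jctx M x b w t z a τ i.castSucc) (JFacts M x b w t z a c τ) tgt) :=
  ⟨JPkg.vacuous p _ _ (fun _ _ hF => hw (hF.w_succ_eq_u_of_closedU i ha')) tgt⟩

/-- **The two vacuities of a `★★` junction**: off `z_k = w_k` or off `w_{k+1} = u_k` the piece is empty.
[cite: FitznerVanDerHofstad2017, (4.62), (4.64) (arXiv:1506.07977v2 pp. 41–42); §5.1 "Elements of the bounds" (p. 49)] -/
theorem nonempty_jPkg_starStar_of_ne (i i₀ : Fin (M + 1)) (hk : i₀.succ = i.castSucc) {u₀ u₁ : Unit}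
    (ha : a i.castSucc = Sum.inr u₀) (ha' : a i.succ = Sum.inr u₁)
    (h : z i.castSucc ≠ w i.castSucc ∨ w i.succ ≠ (b i.castSucc).1) (tgt : ℝ≥0∞) :
    Nonempty (JPkg p (jctx M x b w t z a τ i.castSucc) (JFacts M x b w t z a c τ) tgt) := by
  rcases h with hzw | hw
  · exact nonempty_jPkg_of_closedL_of_ne p M x b w t z a c τ i i₀ hk ha hzw tgt
  · exact nonempty_jPkg_of_closedU_of_ne p M x b w t z a c τ i ha' hw tgt

end Vacuous

end Literature.Probability.FitznerVanDerHofstad2017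

/-! ### B. The lower-`★` target families -/

namespace Literature.Probability.FitznerVanDerHofstad2017.NobleBlocks

open Literature.Probability.LatticeModels

variable {d : ℕ}

section Targets

variable (L : Letters d) (κ : Fin d × Bool) (a' : Fin 3) (u w t z w' u' : Site d)

/-- **The lower-`★` target family** of a junction over a CLOSED level with regular upper class `a′`, indexed by
the variant `v`: the pinned section `z = w` of ROW `a = 2` of the regular family `tgtReg`.
[cite: FitznerVanDerHofstad2017, §5.1 (5.4) (arXiv:1506.07977v2 p. 48) and "Elements of the bounds" (p. 49); §6.1 (6.4) (p. 58)] -/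
def tgtStarL (v : Bool × Fin 3) : ℝ≥0∞ := if z = w then tgtReg L κ 2 a' u w t z w' u' v else 0

/-- [cite: FitznerVanDerHofstad2017, §5.1 (5.4) (arXiv:1506.07977v2 p. 48)] -/
theorem tgtStarL_of_ne (h : z ≠ w) (v : Bool × Fin 3) : tgtStarL L κ a' u w t z w' u' v = 0 := if_neg h

/-- [cite: FitznerVanDerHofstad2017, §5.1 (5.4) (arXiv:1506.07977v2 p. 48)] -/
theorem tgtStarL_of_eq (h : z = w) (v : Bool × Fin 3) :
    tgtStarL L κ a' u w t z w' u' v = tgtReg L κ 2 a' u w t z w' u' v := if_pos h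

/-- The `F‴` rows of the lower-`★` family in the shape of the `NobleBoundsNLowStar` cells
(`A'^{κ,2,c,*} = A^{κ,2,c,*}`: the primed cross-letter differs from the unprimed one only at `(a, c) = (0, 0)`).
[cite: FitznerVanDerHofstad2017, §5.1 (5.4) first summand (arXiv:1506.07977v2 p. 48); App. B row a ≥ 2 (p. 75)] -/
theorem tgtStarL_false (c : Fin 3) :
    tgtStarL L κ a' u w t z w' u' (false, c) =
      (if z = w then blockAiotaSt L κ 2 c u w t z else 0) * blockA L c a' t z w' u' := by
  by_cases h : z = w
  · rw [tgtStarL_of_eq L κ a' u w t z w' u' h, if_pos h, tgtReg_false,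
      blockAiotaSt'_of_ne L κ (a := 2) (b := c) fun h' => absurd h'.1 (by decide)]
  · rw [tgtStarL_of_ne L κ a' u w t z w' u' h, if_neg h, zero_mul]

/-- **`hT` on a lower-`★` column**: `Σ_v tgtStarL ≤ 𝟙{z = w} · B'_pt^{κ,2,a′}(u,w,t,z,w′,u′)` — the pinned section
`secEopt` of the pointwise middle block (5.4), for every four-line family `X`.
[cite: FitznerVanDerHofstad2017, §5.1 (5.4) (arXiv:1506.07977v2 p. 48) and "Elements of the bounds" (p. 49); §6.1 (6.4) (p. 58)] -/
theorem sum_tgtStarL_le (X : DirBlockFamilyPt d) :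
    ∑ v, tgtStarL L κ a' u w t z w' u' v ≤ if z = w then blockBFullpt' L X κ 2 a' u w t z w' u' else 0 := by
  by_cases h : z = w
  · simp only [tgtStarL_of_eq L κ a' u w t z w' u' h, if_pos h]
    exact sum_tgtReg_le_blockBFullpt' L κ 2 a' u w t z w' u' X
  · simp [tgtStarL_of_ne L κ a' u w t z w' u' h, if_neg h]

/-- `hT` over any sub-family of variants. [cite: FitznerVanDerHofstad2017, §5.1 (5.4) (arXiv:1506.07977v2 p. 48); §6.1 (6.4) (p. 58)] -/
theorem sum_filter_tgtStarL_le (X : DirBlockFamilyPt d) (P : Bool × Fin 3 → Prop) [DecidablePred P] :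
    ∑ v ∈ Finset.univ.filter P, tgtStarL L κ a' u w t z w' u' v ≤
      if z = w then blockBFullpt' L X κ 2 a' u w t z w' u' else 0 :=
  (Finset.sum_le_sum_of_subset (Finset.filter_subset _ _)).trans (sum_tgtStarL_le L κ a' u w t z w' u' X)

end Targets

section TargetsLU

variable (L : Letters d) (κ : Fin d × Bool) (u w t z w' u' : Site d)

/-- **The `★★` target family** (both levels of the junction closed): the pinned section `z = w` of the upper-`★`
family at lower class `2`, i.e. of `tgtReg` at `(2, 0)` in the closed section `w′ := u′` with the `F′`-row on the
pin. [cite: FitznerVanDerHofstad2017, §5.1 (5.4) (arXiv:1506.07977v2 p. 48) and "Elements of the bounds" (p. 49); §6.1 (6.4) (p. 58)] -/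
def tgtStarLU (v : Bool × Fin 3) : ℝ≥0∞ := if z = w then tgtStarU L κ 2 u w t z w' u' v else 0

/-- [cite: FitznerVanDerHofstad2017, §5.1 (5.4) (arXiv:1506.07977v2 p. 48)] -/
theorem tgtStarLU_of_ne (h : z ≠ w) (v : Bool × Fin 3) : tgtStarLU L κ u w t z w' u' v = 0 := if_neg h

/-- [cite: FitznerVanDerHofstad2017, §5.1 (5.4) (arXiv:1506.07977v2 p. 48)] -/
theorem tgtStarLU_of_eq (h : z = w) (v : Bool × Fin 3) :
    tgtStarLU L κ u w t z w' u' v = tgtStarU L κ 2 u w t z w' u' v := if_pos h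

/-- **`hT` on a `★★` column**: `Σ_v tgtStarLU ≤ 𝟙{w′ = u} 𝟙{z = w} B'_pt^{κ,2,0}(u,w,t,z,u′,u′)` — the section
`secEocpt` of the pointwise middle block (5.4), for every four-line family `X`.
[cite: FitznerVanDerHofstad2017, §5.1 (5.4) (arXiv:1506.07977v2 p. 48) and "Elements of the bounds" (p. 49); §6.1 (6.4) (p. 58)] -/
theorem sum_tgtStarLU_le (X : DirBlockFamilyPt d) :
    ∑ v, tgtStarLU L κ u w t z w' u' v ≤
      if w' = u then (if z = w then blockBFullpt' L X κ 2 0 u w t z u' u' else 0) else 0 := by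
  by_cases h : z = w
  · simp only [tgtStarLU_of_eq L κ u w t z w' u' h, if_pos h]
    exact sum_tgtStarU_le L κ 2 u w t z w' u' X
  · simp [tgtStarLU_of_ne L κ u w t z w' u' h, if_neg h]

/-- `hT` over any sub-family of variants. [cite: FitznerVanDerHofstad2017, §5.1 (5.4) (arXiv:1506.07977v2 p. 48); §6.1 (6.4) (p. 58)] -/
theorem sum_filter_tgtStarLU_le (X : DirBlockFamilyPt d) (P : Bool × Fin 3 → Prop) [DecidablePred P] :
    ∑ v ∈ Finset.univ.filter P, tgtStarLU L κ u w t z w' u' v ≤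
      if w' = u then (if z = w then blockBFullpt' L X κ 2 0 u w t z u' u' else 0) else 0 :=
  (Finset.sum_le_sum_of_subset (Finset.filter_subset _ _)).trans (sum_tgtStarLU_le L κ u w t z w' u' X)

end TargetsLU

end Literature.Probability.FitznerVanDerHofstad2017.NobleBlocks

/-! ### C. The dispatch over a closed level -/

namespace Literature.Probability.FitznerVanDerHofstad2017

open Literature.Barriers.CriticalPhenomena Literature.Probability.Percolation
open Literature.Probability.LatticeModels Literature.Combinatorics.SimpleGraph _root_.SimpleGraph
open _root_.MeasureTheory
open Literature.Probability.FitznerVanDerHofstad2017.NobleBlocks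
open Literature.Probability.FitznerVanDerHofstad2017.NobleBlocks.LenIdx

variable {d : ℕ}

section Packages

variable (p : unitInterval) (M : ℕ) (x : Site d) (b : Fin (M + 2) → Site d × Site d) (w t z : Fin (M + 2) → Site d)
  (a : Fin (M + 2) → Fin 3 ⊕ Unit) (c : Fin 3 ⊕ Unit) (τ : Fin (M + 1) → Bool × Fin 3)

local notation "𝐋" => Letters.perc d p

/-- **`pkg` at a MIDDLE junction `k = i₀ + 1 ≤ M` over a closed level** (`a_k = ★`, `a_{k+1} = a′` regular): a
package with target `tgtStarL 𝐋 κ a′ (u_k,w_k,t_k,z_k,w_{k+1},u_{k+1}) (τ i)`, GIVEN packages with that target for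
the cells not yet in the tree — `hR'` (the corner `w_{k+1} = t_k` of the `F‴` rows, `a′ ≠ 0`: DIVERGENCE D77-R′
over `★`), `hF1` (the `F′` row on the pin `t_k = u_{k+1}`, inner class `0`, over `★`), `hE` (the `F″` rows `a′ = 2`
off the pin over `★`; at inner class `0` only with `z_k = t_k`, the other case being empty).  Every other case is
routed to `NobleBoundsNLowStar` (`F‴`: `…_lowStar_zeroExit`, `…_lowStar_open`) or is empty
(`JFacts.pin_closedL` off `z_k = w_k`; `nonempty_jPkg_of_sharp`, `…_of_innerClass_zero_ne / _ne_zero_eq`,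
`…_of_midE_t_eq_z_ne`).
[cite: FitznerVanDerHofstad2017, §6.1 (6.4) "Case a ≥ 2" × "Case b = 0 / 1 / ≥ 2" (arXiv:1506.07977v2 pp. 58–59); §5.1 (5.4) (p. 48) and "Elements of the bounds" (p. 49); (4.58), (4.62), (4.64) (pp. 41–42); App. B (pp. 74–76)] -/
theorem nonempty_jPkg_mid_starL (i i₀ : Fin (M + 1)) (hk : i₀.succ = i.castSucc) (κ : Fin d × Bool)
    (hb : (b i.castSucc).2 = (b i.castSucc).1 + stepVec κ) {u₀ : Unit} (ha : a i.castSucc = Sum.inr u₀)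
    (a' : Fin 3) (ha' : a i.succ = Sum.inl a')
    (hR' : (τ i).1 = false → a' ≠ 0 → w i.succ = t i.castSucc →
      Nonempty (JPkg p (jctx M x b w t z a τ i.castSucc) (JFacts M x b w t z a c τ)
        (tgtStarL 𝐋 κ a' (b i.castSucc).1 (w i.castSucc) (t i.castSucc) (z i.castSucc) (w i.succ) (b i.succ).1
          (τ i))))
    (hF1 : (τ i).1 = true → (τ i).2 = 0 → t i.castSucc = (b i.succ).1 →
      Nonempty (JPkg p (jctx M x b w t z a τ i.castSucc) (JFacts M x b w t z a c τ)
        (tgtStarL 𝐋 κ a' (b i.castSucc).1 (w i.castSucc) (t i.castSucc) (z i.castSucc) (w i.succ) (b i.succ).1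
          (τ i))))
    (hE : (τ i).1 = true → a' = 2 → t i.castSucc ≠ (b i.succ).1 → ((τ i).2 = 0 → z i.castSucc = t i.castSucc) →
      Nonempty (JPkg p (jctx M x b w t z a τ i.castSucc) (JFacts M x b w t z a c τ)
        (tgtStarL 𝐋 κ a' (b i.castSucc).1 (w i.castSucc) (t i.castSucc) (z i.castSucc) (w i.succ) (b i.succ).1
          (τ i)))) :
    Nonempty (JPkg p (jctx M x b w t z a τ i.castSucc) (JFacts M x b w t z a c τ)
      (tgtStarL 𝐋 κ a' (b i.castSucc).1 (w i.castSucc) (t i.castSucc) (z i.castSucc) (w i.succ) (b i.succ).1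
        (τ i))) := by
  -- off the pinned section the piece is empty
  by_cases hzw : z i.castSucc = w i.castSucc
  swap
  · exact nonempty_jPkg_of_closedL_of_ne p M x b w t z a c τ i i₀ hk ha hzw _
  rcases Bool.eq_false_or_eq_true (τ i).1 with hσ | hσ
  · -- `σ = true`: variants `F′` / `F″`
    by_cases hty : t i.castSucc = (b i.succ).1
    · -- on the pin `t_k = u_{k+1}` (`F′`)
      by_cases hc : (τ i).2 = 0
      · exact hF1 hσ hc hty
      · by_cases hzt : z i.castSucc = t i.castSucc
        · exact nonempty_jPkg_of_innerClass_ne_zero_eq p c _ i hc hzt.symm _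
        · exact nonempty_jPkg_of_midE_t_eq_z_ne p M x b w t z a c τ _ i hσ ha' hty hzt _
    · by_cases ha'2 : a' = 2
      · by_cases hc : (τ i).2 = 0
        · by_cases hzt : z i.castSucc = t i.castSucc
          · exact hE hσ ha'2 hty fun _ => hzt
          · exact nonempty_jPkg_of_innerClass_zero_ne p c _ i hc (Ne.symm hzt) _
        · exact hE hσ ha'2 hty fun h => absurd h hc
      · exact nonempty_jPkg_of_sharp p c _ i hσ ha' ha'2 hty _
  · -- `σ = false`: variant `F‴`, the `NobleBoundsNLowStar` cells
    have hv : τ i = (false, (τ i).2) := Prod.ext hσ rfl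
    by_cases ha'0 : a' = 0
    · subst ha'0
      rw [hv, tgtStarL_false]
      exact nonempty_jPkg_lowStar_zeroExit p M x b w t z a c τ i i₀ hk κ hb hσ (τ i).2 rfl ha ha'
    · by_cases hwt : w i.succ = t i.castSucc
      · exact hR' hσ ha'0 hwt
      · rw [hv, tgtStarL_false]
        exact nonempty_jPkg_lowStar_open p M x b w t z a c τ i i₀ hk κ hb hσ (τ i).2 rfl ha ha' ha'0 hwt

end Packages

end Literature.Probability.FitznerVanDerHofstad2017

end
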